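import Summits.AtomisticToContinuum.FouriersLaw.Theorems.BondHeatUncertaintyLinearResponseFTURItoSums
import Summits.AtomisticToContinuum.FouriersLaw.Theorems.BondHeatUncertaintyLinearResponseFTURScheme

/-!
# Identification of the limits of the discrete log-density sums (K3 helper)

Helper file for stub `stub_antiDampedGirsanov` (K3) of line `lebesgue-flip-duality`, crux ★
`BondHeatUncertainty.LinearResponseFTUR` (stmt-AtomisticToContinuum-9122). Per bath `b` (momentum `p_b`,
amplitude `c`, signs `(ε, σ)`, clamp `R`) the log-density of the discrete Cameron–Martin identity is
`(2γ/c) Σ_k clamp_R(p_b(z_m(kh))) ΔB_k - (γ/T_b) Σ_k h clamp_R(p_b(z_m(kh)))²` along scheme paths `z_m`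
(mesh `h = t/2^m`). Both sums are identified PATHWISE given uniform convergence `z_m → X`, the node
recursion of the scheme, the `p_b`-component of the integral equation of `X` (bath momentum in
`[-(R-1), R-1]`, so the clamp is eventually inactive) and the dyadic quadratic variation `Σ(ΔB_k)² → t`:
`tendsto_riemann_clamp_sq` and `tendsto_ito_clamp` (via `tendsto_itoSum_of_nodes` and the calculus identity
`ito_correction_identity`). Deterministic real analysis.
-/

noncomputable section
namespace Summit.AtomisticToContinuum.FouriersLaw.Theorems.LinearResponseFTUR

open MeasureTheory Filter Set Function Finset intervalIntegral Topology Metric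
open Literature.MathematicalPhysics.KineticTheory
open Literature.MathematicalPhysics.KineticTheory.HeatConduction

variable {N : ℕ}
/-! ### The calculus identity behind the Itô correction -/
/-- If `p = a₀ + κ B + ∫₀ g` on `[0, t]`, then
`κ[(a₀ + ∫₀ᵗ g) B(t) - ∫₀ᵗ B g] + κ² B(t)²/2 = p(t)²/2 - a₀²/2 - ∫₀ᵗ p g`
(the fundamental theorem of calculus for `a²/2`, `a = a₀ + ∫₀ g`). -/
theorem ito_correction_identity {a₀ κ t : ℝ} (ht : 0 ≤ t) {B g p : ℝ → ℝ} (hB : Continuous B)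
    (hg : Continuous g)
    (hp : ∀ u ∈ Icc 0 t, p u = a₀ + κ * B u + ∫ v in (0 : ℝ)..u, g v) :
    κ * ((a₀ + ∫ u in (0 : ℝ)..t, g u) * B t - ∫ u in (0 : ℝ)..t, B u * g u) + κ ^ 2 / 2 * B t ^ 2 =
      p t ^ 2 / 2 - a₀ ^ 2 / 2 - ∫ u in (0 : ℝ)..t, p u * g u := by
  set a : ℝ → ℝ := fun u => a₀ + ∫ v in (0 : ℝ)..u, g v with ha
  have hga : ∀ u, HasDerivAt a (g u) u := fun u => by
    have h := intervalIntegral.integral_hasDerivAt_right (hg.intervalIntegrable 0 u)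
      (hg.stronglyMeasurableAtFilter volume (𝓝 u)) hg.continuousAt
    simpa [ha] using h.const_add a₀
  have hac : Continuous a := continuous_iff_continuousAt.2 fun u => (hga u).continuousAt
  have hFTC : ∫ u in (0 : ℝ)..t, a u * g u = a t ^ 2 / 2 - a₀ ^ 2 / 2 := by
    have hderiv : ∀ u ∈ uIcc 0 t, HasDerivAt (fun u => a u ^ 2 / 2) (a u * g u) u := by
      intro u _
      have h2 : HasDerivAt (fun u => a u * a u / 2) ((g u * a u + a u * g u) / 2) u :=
        ((hga u).mul (hga u)).div_const 2
      have heq : (fun u => a u ^ 2 / 2) = fun u => a u * a u / 2 := by funext u; ring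
      have h3 : (g u * a u + a u * g u) / 2 = a u * g u := by ring
      rw [heq, ← h3]
      exact h2
    have hi : IntervalIntegrable (fun u => a u * g u) volume 0 t := (hac.mul hg).intervalIntegrable 0 t
    rw [integral_eq_sub_of_hasDerivAt hderiv hi]
    simp [ha]
  have hpg : ∫ u in (0 : ℝ)..t, p u * g u =
      (∫ u in (0 : ℝ)..t, a u * g u) + κ * ∫ u in (0 : ℝ)..t, B u * g u := by
    have hi1 : IntervalIntegrable (fun u => a u * g u) volume 0 t := (hac.mul hg).intervalIntegrable 0 t
    have hi2 : IntervalIntegrable (fun u => κ * (B u * g u)) volume 0 t :=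
      (continuous_const.mul (hB.mul hg)).intervalIntegrable 0 t
    rw [← intervalIntegral.integral_const_mul, ← intervalIntegral.integral_add hi1 hi2]
    refine integral_congr fun u hu => ?_
    rw [uIcc_of_le ht] at hu
    simp only [hp u hu, ha]
    ring
  have hpt : p t = a t + κ * B t := by simp only [hp t ⟨ht, le_rfl⟩, ha]; ring
  rw [hpg, hFTC, hpt]
  simp only [ha]
  ring
/-- A momentum coordinate is `1`-Lipschitz for the phase-space norm. -/
theorem abs_snd_sub_snd_le (v w : PhaseSpace N) (b : Fin N) : |v.2 b - w.2 b| ≤ ‖v - w‖ := by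
  rw [← Real.norm_eq_abs, show v.2 b - w.2 b = (v - w).2 b from rfl]
  exact (norm_le_pi_norm _ b).trans (norm_snd_le _)
/-! ### The two limits -/
section Limits

variable {t : ℝ} (ht : 0 < t) (b : Fin N) {z : ℕ → ℝ → PhaseSpace N} {X : ℝ → PhaseSpace N}
  (hXc : Continuous X)
  (hconv : ∀ η : ℝ, 0 < η → ∀ᶠ m : ℕ in atTop, ∀ s ∈ Icc 0 t, ‖z m s - X s‖ ≤ η)
  {R : ℝ} (hXR : ∀ s ∈ Icc 0 t, |(X s).2 b| ≤ R - 1)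
include ht hXc hconv hXR

omit ht hXc in
/-- Eventually the clamp is inactive at the scheme values and they are uniformly close to `p_b(X)`. -/
theorem eventually_clamp_close {η : ℝ} (hη : 0 < η) (hη1 : η ≤ 1) :
    ∀ᶠ m : ℕ in atTop, ∀ s ∈ Icc 0 t,
      clampR R ((z m s).2 b) = (z m s).2 b ∧ |(z m s).2 b - (X s).2 b| ≤ η := by
  filter_upwards [hconv η hη] with m hm s hs
  have hd : |(z m s).2 b - (X s).2 b| ≤ η := (abs_snd_sub_snd_le _ _ b).trans (hm s hs)
  refine ⟨clampR_of_abs_le ?_, hd⟩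
  have h1 := hXR s hs
  have h2 : |(z m s).2 b| ≤ |(z m s).2 b - (X s).2 b| + |(X s).2 b| := by
    have := abs_add_le ((z m s).2 b - (X s).2 b) ((X s).2 b)
    rwa [sub_add_cancel] at this
  linarith
/-- **The Riemann sums of the clamped squared bath momentum at the scheme nodes converge**:
`Σ_{k<2^m} h clamp_R(p_b(z_m(kh)))² → ∫₀ᵗ p_b(X)²`. -/
theorem tendsto_riemann_clamp_sq :
    Tendsto (fun m : ℕ => ∑ k ∈ range (2 ^ m),
        t / 2 ^ m * clampR R ((z m ((k : ℝ) * (t / 2 ^ m))).2 b) ^ 2) atTop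
      (𝓝 (∫ u in (0 : ℝ)..t, (X u).2 b ^ 2)) := by
  have hR1 : 1 ≤ R := by have := (abs_nonneg _).trans (hXR 0 ⟨le_rfl, ht.le⟩); linarith
  -- the Riemann sums with the exact nodes `p_b(X(kh))²`
  have hφ : Continuous fun u => (X u).2 b ^ 2 := ((continuous_apply b).comp (continuous_snd.comp hXc)).pow 2
  have hRS := tendsto_sum_mul_integral_of_continuous hφ continuous_const (g := fun _ => (1 : ℝ)) ht.le
    (fun n k => (k : ℝ) * (t / n)) fun n k _ => ⟨le_rfl, by nlinarith [div_nonneg ht.le n.cast_nonneg]⟩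
  have hRS2 := hRS.comp tendsto_two_pow_atTop
  simp only [mul_one, intervalIntegral.integral_const, smul_eq_mul, Function.comp_def, Nat.cast_pow,
    Nat.cast_ofNat] at hRS2
  have hcell : ∀ (m k : ℕ), ((k : ℝ) + 1) * (t / 2 ^ m) - (k : ℝ) * (t / 2 ^ m) = t / 2 ^ m := by
    intro m k; ring
  simp only [hcell] at hRS2
  -- the difference tends to zero
  have hdiff : Tendsto (fun m : ℕ => ∑ k ∈ range (2 ^ m),
      (t / 2 ^ m * clampR R ((z m ((k : ℝ) * (t / 2 ^ m))).2 b) ^ 2 -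
        (X ((k : ℝ) * (t / 2 ^ m))).2 b ^ 2 * (t / 2 ^ m))) atTop (𝓝 0) := by
    rw [Metric.tendsto_atTop]
    intro η hη
    set η' : ℝ := min 1 (η / (2 * (t * (2 * R) + 1))) with hη'
    have hη'0 : 0 < η' := by positivity
    have hη'1 : η' ≤ 1 := min_le_left _ _
    obtain ⟨m₀, hm₀⟩ := eventually_atTop.1 (eventually_clamp_close b hconv hXR hη'0 hη'1)
    refine ⟨m₀, fun m hm => ?_⟩
    rw [dist_zero_right, Real.norm_eq_abs]
    have hnode : ∀ k ∈ range (2 ^ m), (k : ℝ) * (t / 2 ^ m) ∈ Icc 0 t := by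
      intro k hk
      have hk' : (k : ℝ) ≤ 2 ^ m := by exact_mod_cast (mem_range.1 hk).le
      refine ⟨by positivity, ?_⟩
      calc (k : ℝ) * (t / 2 ^ m) ≤ 2 ^ m * (t / 2 ^ m) := mul_le_mul_of_nonneg_right hk' (by positivity)
        _ = t := mul_div_cancel₀ _ (pow_ne_zero _ two_ne_zero)
    have hterm : ∀ k ∈ range (2 ^ m),
        |t / 2 ^ m * clampR R ((z m ((k : ℝ) * (t / 2 ^ m))).2 b) ^ 2 -
          (X ((k : ℝ) * (t / 2 ^ m))).2 b ^ 2 * (t / 2 ^ m)| ≤ t / 2 ^ m * (η' * (2 * R)) := by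
      intro k hk
      obtain ⟨hcl, hd⟩ := hm₀ m hm _ (hnode k hk)
      rw [hcl]
      set v := (z m ((k : ℝ) * (t / 2 ^ m))).2 b
      set p := (X ((k : ℝ) * (t / 2 ^ m))).2 b
      have hp : |p| ≤ R - 1 := hXR _ (hnode k hk)
      have h1 : t / 2 ^ m * v ^ 2 - p ^ 2 * (t / 2 ^ m) = t / 2 ^ m * ((v - p) * (v + p)) := by ring
      rw [h1, abs_mul, abs_of_pos (by positivity : (0 : ℝ) < t / 2 ^ m), abs_mul]
      refine mul_le_mul_of_nonneg_left ?_ (by positivity)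
      refine mul_le_mul hd ?_ (abs_nonneg _) hη'0.le
      have : |v + p| ≤ |v - p| + |p| + |p| := by
        have h := abs_add_le (v - p) (p + p)
        rw [show v - p + (p + p) = v + p by ring] at h
        linarith [abs_add_le p p]
      linarith
    calc |∑ k ∈ range (2 ^ m), (t / 2 ^ m * clampR R ((z m ((k : ℝ) * (t / 2 ^ m))).2 b) ^ 2 -
            (X ((k : ℝ) * (t / 2 ^ m))).2 b ^ 2 * (t / 2 ^ m))|
        ≤ ∑ k ∈ range (2 ^ m), t / 2 ^ m * (η' * (2 * R)) := (abs_sum_le_sum_abs _ _).trans (sum_le_sum hterm)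
      _ = t * (2 * R) * η' := by
          rw [sum_const, card_range, nsmul_eq_mul]; push_cast; field_simp
      _ < η := by
          have hA : 0 ≤ t * (2 * R) := mul_nonneg ht.le (by linarith)
          have h1 : η' ≤ η / (2 * (t * (2 * R) + 1)) := min_le_right _ _
          have h2 : t * (2 * R) * η' ≤ t * (2 * R) * (η / (2 * (t * (2 * R) + 1))) :=
            mul_le_mul_of_nonneg_left h1 hA
          have h3 : t * (2 * R) * (η / (2 * (t * (2 * R) + 1))) ≤ η / 2 := by
            rw [mul_div_assoc', div_le_div_iff₀ (by positivity) two_pos]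
            nlinarith
          linarith [half_lt_self hη]
  have h := hRS2.add hdiff
  rw [add_zero] at h
  refine h.congr fun m => ?_
  rw [← sum_add_distrib]
  refine sum_congr rfl fun k _ => ?_
  ring
/-- **The Itô sums of the clamped bath momentum at the scheme nodes converge**: with `κ = ε c ≠ 0`,
`Σ_{k<2^m} clamp_R(p_b(z_m(kh))) ΔB_k → (p_b(X(t))²/2 - p_b(y)²/2 - ∫₀ᵗ p_b(X) Y_b(X) + σγ ∫₀ᵗ p_b(X)² - κ²t/2)/κ`. -/
theorem tendsto_ito_clamp {B : ℝ → ℝ} (hB : Continuous B) (hB0 : B 0 = 0) {Yb : PhaseSpace N → ℝ}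
    (hYb : Continuous Yb) {ε σ γ c : ℝ} (hκ : ε * c ≠ 0) (y : PhaseSpace N) (hzc : ∀ m, Continuous (z m))
    (hnode : ∀ m k : ℕ, k < 2 ^ m →
      (z m (((k : ℝ) + 1) * (t / 2 ^ m))).2 b = (z m ((k : ℝ) * (t / 2 ^ m))).2 b +
        ε * c * (B (((k : ℝ) + 1) * (t / 2 ^ m)) - B ((k : ℝ) * (t / 2 ^ m))) -
        σ * γ * (t / 2 ^ m) * clampR R ((z m ((k : ℝ) * (t / 2 ^ m))).2 b) +
        ∫ u in ((k : ℝ) * (t / 2 ^ m))..(((k : ℝ) + 1) * (t / 2 ^ m)), Yb (z m u))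
    (hXb : ∀ s ∈ Icc 0 t, (X s).2 b = y.2 b + ε * c * B s - σ * γ * (∫ u in (0 : ℝ)..s, (X u).2 b) +
      ∫ u in (0 : ℝ)..s, Yb (X u))
    (hQV : Tendsto (fun m : ℕ => ∑ k ∈ range (2 ^ m),
      (B (((k : ℝ) + 1) * (t / 2 ^ m)) - B ((k : ℝ) * (t / 2 ^ m))) ^ 2) atTop (𝓝 t)) :
    Tendsto (fun m : ℕ => ∑ k ∈ range (2 ^ m), clampR R ((z m ((k : ℝ) * (t / 2 ^ m))).2 b) *
        (B (((k : ℝ) + 1) * (t / 2 ^ m)) - B ((k : ℝ) * (t / 2 ^ m)))) atTop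
      (𝓝 (((X t).2 b ^ 2 / 2 - y.2 b ^ 2 / 2 - (∫ u in (0 : ℝ)..t, (X u).2 b * Yb (X u)) +
        σ * γ * (∫ u in (0 : ℝ)..t, (X u).2 b ^ 2) - (ε * c) ^ 2 * t / 2) / (ε * c))) := by
  have hR1 : 1 ≤ R := by have := (abs_nonneg _).trans (hXR 0 ⟨le_rfl, ht.le⟩); linarith
  -- the data of `tendsto_itoSum_of_nodes`
  set κ : ℝ := ε * c with hκdef
  set a₀ : ℝ := y.2 b with ha₀
  set p : ℝ → ℝ := fun u => (X u).2 b with hpdef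
  have hpc : Continuous p := (continuous_apply b).comp (continuous_snd.comp hXc)
  set g : ℝ → ℝ := fun u => -(σ * γ) * p u + Yb (X u) with hgdef
  have hgc : Continuous g := (continuous_const.mul hpc).add (hYb.comp hXc)
  have hint_g : ∀ s₁ s₂ : ℝ, ∫ u in s₁..s₂, g u =
      -(σ * γ) * (∫ u in s₁..s₂, p u) + ∫ u in s₁..s₂, Yb (X u) := by
    intro s₁ s₂
    simp only [hgdef]
    have hi1 : IntervalIntegrable (fun u => -(σ * γ) * p u) volume s₁ s₂ :=
      (continuous_const.mul hpc).intervalIntegrable _ _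
    have hi2 : IntervalIntegrable (fun u => Yb (X u)) volume s₁ s₂ := (hYb.comp hXc).intervalIntegrable _ _
    rw [intervalIntegral.integral_add hi1 hi2, intervalIntegral.integral_const_mul]
  have hp_eq : ∀ u ∈ Icc 0 t, p u = a₀ + κ * B u + ∫ v in (0 : ℝ)..u, g v := by
    intro u hu
    simp only [hpdef, ha₀, hκdef, hint_g]
    rw [hXb u hu]
    ring
  set α : ℕ → ℕ → ℝ := fun m k => clampR R ((z m ((k : ℝ) * (t / 2 ^ m))).2 b) - κ * B ((k : ℝ) * (t / 2 ^ m))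
    with hαdef
  set err : ℕ → ℕ → ℝ := fun m k => (α m (k + 1) - α m k) -
      ∫ u in ((k : ℝ) * (t / 2 ^ m))..(((k : ℝ) + 1) * (t / 2 ^ m)), g u with herr
  have hne : ∀ m : ℕ, (range (2 ^ m)).Nonempty := fun m => ⟨0, by simp⟩
  set δ : ℕ → ℝ := fun m => (range (2 ^ m)).sup' (hne m) fun k => |err m k| / (t / 2 ^ m) with hδdef
  have hmesh : ∀ m : ℕ, (0 : ℝ) < t / 2 ^ m := fun m => by positivity
  have hδ0 : ∀ m, 0 ≤ δ m := fun m =>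
    (div_nonneg (abs_nonneg (err m 0)) (hmesh m).le).trans
      (le_sup' (fun k => |err m k| / (t / 2 ^ m)) (mem_range.2 (pow_pos two_pos m)))
  have hstep : ∀ m k : ℕ, k < 2 ^ m →
      |(α m (k + 1) - α m k) - ∫ u in ((k : ℝ) * (t / 2 ^ m))..(((k : ℝ) + 1) * (t / 2 ^ m)), g u| ≤
        (t / 2 ^ m) * δ m := by
    intro m k hk
    have h1 : |err m k| / (t / 2 ^ m) ≤ δ m := le_sup' (fun k => |err m k| / (t / 2 ^ m)) (mem_range.2 hk)
    have h2 := (div_le_iff₀' (hmesh m)).1 h1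
    simpa only [herr, Nat.cast_add, Nat.cast_one] using h2
  -- nodes lie in `[0, t]`
  have hnode_mem : ∀ m k : ℕ, k ≤ 2 ^ m → (k : ℝ) * (t / 2 ^ m) ∈ Icc 0 t := by
    intro m k hk
    have hk' : (k : ℝ) ≤ 2 ^ m := by exact_mod_cast hk
    refine ⟨by positivity, ?_⟩
    calc (k : ℝ) * (t / 2 ^ m) ≤ 2 ^ m * (t / 2 ^ m) := mul_le_mul_of_nonneg_right hk' (by positivity)
      _ = t := mul_div_cancel₀ _ (pow_ne_zero _ two_ne_zero)
  have hnode_mem' : ∀ m k : ℕ, k < 2 ^ m → ((k : ℝ) + 1) * (t / 2 ^ m) ∈ Icc 0 t := by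
    intro m k hk; have := hnode_mem m (k + 1) hk; push_cast at this; exact this
  -- the core estimate: eventually every step error is `≤ h η`
  have hcore : ∀ η : ℝ, 0 < η → ∀ᶠ m : ℕ in atTop, ∀ k, k < 2 ^ m → |err m k| ≤ t / 2 ^ m * η := by
    intro η hη
    obtain ⟨ρ, hρ⟩ := isCompact_Icc.exists_bound_of_continuousOn (hXc.continuousOn (s := Icc 0 t))
    -- uniform continuity of `Yb` on a compact neighbourhood of the range of `X`
    have hucY := (isCompact_closedBall (0 : PhaseSpace N) (ρ + 1)).uniformContinuousOn_of_continuous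
      hYb.continuousOn
    rw [Metric.uniformContinuousOn_iff_le] at hucY
    obtain ⟨θ₁, hθ₁0, hθ₁⟩ := hucY (η / 3) (by positivity)
    -- uniform continuity of `X` on `[0, t]`
    set η₂ : ℝ := η / (3 * (|σ * γ| + 1)) with hη₂
    have hη₂0 : 0 < η₂ := by positivity
    have hη₂' : |σ * γ| * (2 * η₂) ≤ 2 * η / 3 := by
      have hkey : (|σ * γ| + 1) * η₂ = η / 3 := by
        rw [hη₂, mul_div_assoc', div_eq_div_iff (by positivity) (by norm_num)]
        ring
      calc |σ * γ| * (2 * η₂) ≤ (|σ * γ| + 1) * (2 * η₂) :=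
            mul_le_mul_of_nonneg_right (by linarith) (by positivity)
        _ = 2 * ((|σ * γ| + 1) * η₂) := by ring
        _ = 2 * η / 3 := by rw [hkey]; ring
    have hucX := isCompact_Icc.uniformContinuousOn_of_continuous (hXc.continuousOn (s := Icc 0 t))
    rw [Metric.uniformContinuousOn_iff_le] at hucX
    obtain ⟨θ₂, hθ₂0, hθ₂⟩ := hucX η₂ hη₂0
    set η₃ : ℝ := min 1 (min (θ₁ / 2) η₂) with hη₃
    have hη₃0 : 0 < η₃ := by positivity
    have hη₃1 : η₃ ≤ 1 := min_le_left _ _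
    have hη₃θ : η₃ ≤ θ₁ / 2 := (min_le_right _ _).trans (min_le_left _ _)
    have hη₃η : η₃ ≤ η₂ := (min_le_right _ _).trans (min_le_right _ _)
    have hev_mesh : ∀ᶠ m : ℕ in atTop, t / 2 ^ m ≤ θ₂ / 2 :=
      (tendsto_const_nhds.div_atTop (tendsto_pow_atTop_atTop_of_one_lt one_lt_two)).eventually
        (eventually_le_nhds (by positivity))
    filter_upwards [hconv η₃ hη₃0, eventually_clamp_close b hconv hXR hη₃0 hη₃1, hev_mesh]
      with m hm hclamp hmsh k hk
    have hkh := hnode_mem m k hk.le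
    have hk1h := hnode_mem' m k hk
    obtain ⟨hcl0, hd0⟩ := hclamp _ hkh
    obtain ⟨hcl1, -⟩ := hclamp _ hk1h
    -- the step error as a sum of two cell integrals
    have hcellc : ∀ {f : ℝ → ℝ}, Continuous f → IntervalIntegrable f volume ((k : ℝ) * (t / 2 ^ m))
        (((k : ℝ) + 1) * (t / 2 ^ m)) := fun hf => hf.intervalIntegrable _ _
    have hYz : Continuous fun u => Yb (z m u) := hYb.comp (hzc m)
    have hYX : Continuous fun u => Yb (X u) := hYb.comp hXc
    have hcst : Continuous fun _ : ℝ => (z m ((k : ℝ) * (t / 2 ^ m))).2 b := continuous_const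
    have herr_eq : err m k =
        -(σ * γ) * (∫ u in ((k : ℝ) * (t / 2 ^ m))..(((k : ℝ) + 1) * (t / 2 ^ m)),
            ((z m ((k : ℝ) * (t / 2 ^ m))).2 b - p u)) +
          ∫ u in ((k : ℝ) * (t / 2 ^ m))..(((k : ℝ) + 1) * (t / 2 ^ m)), (Yb (z m u) - Yb (X u)) := by
      simp only [herr, hαdef, Nat.cast_add, Nat.cast_one]
      rw [intervalIntegral.integral_sub (hcellc hcst) (hcellc hpc),
        intervalIntegral.integral_sub (hcellc hYz) (hcellc hYX), hint_g,
        intervalIntegral.integral_const, smul_eq_mul, hcl0, hcl1]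
      have hn := hnode m k hk
      rw [hcl0] at hn
      rw [hn]
      ring
    rw [herr_eq]
    -- bound the two cell integrals
    have hlen : |((k : ℝ) + 1) * (t / 2 ^ m) - (k : ℝ) * (t / 2 ^ m)| = t / 2 ^ m := by
      rw [show ((k : ℝ) + 1) * (t / 2 ^ m) - (k : ℝ) * (t / 2 ^ m) = t / 2 ^ m by ring,
        abs_of_pos (hmesh m)]
    have hcell_sub : ∀ u ∈ Set.uIoc ((k : ℝ) * (t / 2 ^ m)) (((k : ℝ) + 1) * (t / 2 ^ m)),
        u ∈ Icc 0 t ∧ |(k : ℝ) * (t / 2 ^ m) - u| ≤ t / 2 ^ m := by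
      intro u hu
      rw [uIoc_of_le (by nlinarith [(hmesh m).le])] at hu
      refine ⟨⟨hkh.1.trans hu.1.le, hu.2.trans hk1h.2⟩, ?_⟩
      rw [abs_sub_comm, abs_of_pos (by linarith [hu.1])]
      nlinarith [hu.2]
    have hI1 : |∫ u in ((k : ℝ) * (t / 2 ^ m))..(((k : ℝ) + 1) * (t / 2 ^ m)),
        ((z m ((k : ℝ) * (t / 2 ^ m))).2 b - p u)| ≤ 2 * η₂ * (t / 2 ^ m) := by
      rw [← Real.norm_eq_abs]
      refine (intervalIntegral.norm_integral_le_of_norm_le_const fun u hu => ?_).trans (le_of_eq (by rw [hlen]))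
      obtain ⟨hu, hdu⟩ := hcell_sub u hu
      rw [Real.norm_eq_abs]
      have h1 : |(z m ((k : ℝ) * (t / 2 ^ m))).2 b - p ((k : ℝ) * (t / 2 ^ m))| ≤ η₂ := hd0.trans hη₃η
      have h2 : |p ((k : ℝ) * (t / 2 ^ m)) - p u| ≤ η₂ := by
        refine (abs_snd_sub_snd_le _ _ b).trans ?_
        have := hθ₂ _ hkh _ hu (by rw [Real.dist_eq]; linarith)
        rwa [dist_eq_norm] at this
      calc |(z m ((k : ℝ) * (t / 2 ^ m))).2 b - p u|
          ≤ |(z m ((k : ℝ) * (t / 2 ^ m))).2 b - p ((k : ℝ) * (t / 2 ^ m))| + |p ((k : ℝ) * (t / 2 ^ m)) - p u| :=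
            abs_sub_le _ _ _
        _ ≤ 2 * η₂ := by linarith
    have hI2 : |∫ u in ((k : ℝ) * (t / 2 ^ m))..(((k : ℝ) + 1) * (t / 2 ^ m)), (Yb (z m u) - Yb (X u))| ≤
        η / 3 * (t / 2 ^ m) := by
      rw [← Real.norm_eq_abs]
      refine (intervalIntegral.norm_integral_le_of_norm_le_const fun u hu => ?_).trans (le_of_eq (by rw [hlen]))
      obtain ⟨hu, -⟩ := hcell_sub u hu
      rw [Real.norm_eq_abs, ← Real.dist_eq]
      have hXu : X u ∈ closedBall (0 : PhaseSpace N) (ρ + 1) := by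
        rw [mem_closedBall, dist_zero_right]; linarith [hρ u hu]
      have hzu : z m u ∈ closedBall (0 : PhaseSpace N) (ρ + 1) := by
        rw [mem_closedBall, dist_zero_right]
        have := norm_le_of_mem_closedBall hXu
        calc ‖z m u‖ ≤ ‖z m u - X u‖ + ‖X u‖ := norm_le_norm_sub_add _ _
          _ ≤ 1 + ρ := add_le_add ((hm u hu).trans hη₃1) (hρ u hu)
          _ = ρ + 1 := add_comm _ _
      refine hθ₁ _ hzu _ hXu ?_
      rw [dist_eq_norm]; linarith [hm u hu]
    calc |-(σ * γ) * (∫ u in ((k : ℝ) * (t / 2 ^ m))..(((k : ℝ) + 1) * (t / 2 ^ m)),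
            ((z m ((k : ℝ) * (t / 2 ^ m))).2 b - p u)) +
          ∫ u in ((k : ℝ) * (t / 2 ^ m))..(((k : ℝ) + 1) * (t / 2 ^ m)), (Yb (z m u) - Yb (X u))|
        ≤ |σ * γ| * (2 * η₂ * (t / 2 ^ m)) + η / 3 * (t / 2 ^ m) := by
          refine (abs_add_le _ _).trans (add_le_add ?_ hI2)
          rw [abs_mul, abs_neg]
          exact mul_le_mul_of_nonneg_left hI1 (abs_nonneg _)
      _ ≤ t / 2 ^ m * η := by nlinarith [(hmesh m).le, hη₂']
  -- `δ → 0`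
  have hδ : Tendsto δ atTop (𝓝 0) := by
    rw [Metric.tendsto_atTop]
    intro η hη
    obtain ⟨m₀, hm₀⟩ := eventually_atTop.1 (hcore (η / 2) (by positivity))
    refine ⟨m₀, fun m hm => ?_⟩
    rw [dist_zero_right, Real.norm_eq_abs, abs_of_nonneg (hδ0 m)]
    have : δ m ≤ η / 2 := by
      refine sup'_le _ _ fun k hk => ?_
      rw [div_le_iff₀ (hmesh m)]
      have := hm₀ m hm k (mem_range.1 hk)
      linarith
    linarith
  -- `α m (2^m) → a₀ + ∫₀ᵗ g`
  have hcast : ∀ m : ℕ, ((2 ^ m : ℕ) : ℝ) * (t / 2 ^ m) = t := fun m => by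
    push_cast; exact mul_div_cancel₀ _ (pow_ne_zero _ two_ne_zero)
  have hαM : Tendsto (fun m : ℕ => α m (2 ^ m)) atTop (𝓝 (a₀ + ∫ u in (0 : ℝ)..t, g u)) := by
    have hlim : a₀ + ∫ u in (0 : ℝ)..t, g u = p t - κ * B t := by
      rw [hp_eq t ⟨ht.le, le_rfl⟩]; ring
    rw [hlim, Metric.tendsto_atTop]
    intro η hη
    obtain ⟨m₀, hm₀⟩ := eventually_atTop.1
      (eventually_clamp_close b hconv hXR (lt_min one_pos (half_pos hη)) (min_le_left _ _))
    refine ⟨m₀, fun m hm => ?_⟩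
    obtain ⟨hcl, hd⟩ := hm₀ m hm t ⟨ht.le, le_rfl⟩
    simp only [hαdef, hcast m, hcl, Real.dist_eq]
    rw [show (z m t).2 b - κ * B t - (p t - κ * B t) = (z m t).2 b - p t by ring]
    exact (hd.trans (min_le_right _ _)).trans_lt (half_lt_self hη)
  -- the abstract Itô-sum theorem
  have hmain := tendsto_itoSum_of_nodes ht.le hB hB0 hgc a₀ κ α δ hδ hαM hstep hQV
  have hsum_eq : ∀ m : ℕ, ∑ k ∈ range (2 ^ m), (α m k + κ * B ((k : ℝ) * (t / 2 ^ m))) *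
      (B (((k : ℝ) + 1) * (t / 2 ^ m)) - B ((k : ℝ) * (t / 2 ^ m))) =
      ∑ k ∈ range (2 ^ m), clampR R ((z m ((k : ℝ) * (t / 2 ^ m))).2 b) *
        (B (((k : ℝ) + 1) * (t / 2 ^ m)) - B ((k : ℝ) * (t / 2 ^ m))) := by
    intro m
    refine sum_congr rfl fun k _ => ?_
    simp only [hαdef, sub_add_cancel]
  simp only [hsum_eq] at hmain
  -- identify the limit
  have hident := ito_correction_identity ht.le hB hgc hp_eq
  have hpg : ∫ u in (0 : ℝ)..t, p u * g u =
      -(σ * γ) * (∫ u in (0 : ℝ)..t, (X u).2 b ^ 2) + ∫ u in (0 : ℝ)..t, (X u).2 b * Yb (X u) := by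
    simp only [hgdef, hpdef]
    have hi1 : IntervalIntegrable (fun u => -(σ * γ) * ((X u).2 b ^ 2)) volume 0 t :=
      (continuous_const.mul (hpc.pow 2)).intervalIntegrable 0 t
    have hi2 : IntervalIntegrable (fun u => (X u).2 b * Yb (X u)) volume 0 t :=
      (hpc.mul (hYb.comp hXc)).intervalIntegrable 0 t
    rw [← intervalIntegral.integral_const_mul, ← intervalIntegral.integral_add hi1 hi2]
    refine integral_congr fun u _ => ?_
    ring
  convert hmain using 2
  rw [div_eq_iff hκ]
  rw [hpg] at hident
  simp only [hpdef] at hident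
  linear_combination (-1 : ℝ) * hident
end Limits
/-- **The calculus identity behind the Itô correction** — `∀`-form registered as a sub-goal of the crux item. -/
theorem ito_correction :
    ∀ (a₀ κ t : ℝ), 0 ≤ t → ∀ (B g p : ℝ → ℝ), Continuous B → Continuous g → (∀ u ∈ Set.Icc 0 t, p u = a₀ + κ * B u + ∫ v in (0 : ℝ)..u, g v) → κ * ((a₀ + ∫ u in (0 : ℝ)..t, g u) * B t - ∫ u in (0 : ℝ)..t, B u * g u) + κ ^ 2 / 2 * B t ^ 2 = p t ^ 2 / 2 - a₀ ^ 2 / 2 - ∫ u in (0 : ℝ)..t, p u * g u :=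
  fun _ _ _ ht _ _ _ hB hg hp => ito_correction_identity ht hB hg hp

end Summit.AtomisticToContinuum.FouriersLaw.Theorems.LinearResponseFTUR

end
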